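import Summits.NavierStokesRegularity.NavierStokesRegularity.Theorems.PerpetualPumpAveragedTypeIBlowupLinearComparison
import Mathlib.Analysis.Complex.ExponentialBounds

/-!
# Crux `PerpetualPump.AveragedTypeIBlowup` (stmt-NavierStokesRegularity-1835), line `Sketch`:
# tools for the stub `levelOneBond` — the next bond during the transfer pulse

This file collects the Mathlib-only real-analysis tools used by the registered stub
`stub_levelOneBond` of the line skeleton `Cruxes/AveragedTypeIBlowup/Lines/Sketch.lean` (the stub
itself is proved in `PerpetualPumpAveragedTypeIBlowupLevelOneBond.lean`). Data of the stub, in the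
slow time `σ ∈ [0, T]` (`T ≤ 1/10`) of the front counted from ignition: the next bond solves
`y' = K y + f` with rate `K = q⁴(qβ − x₂/q − 1)` and forcing `f = q⁴ ε̄q²β² + e_y`, where
`β ∈ [−1/50, B_β]` is the renormalised next carrier, `|x₂| ≤ 1/2`, `q ∈ [1, 21/20]`, and the
memory error `|e_y| ≤ η q⁴ my` is controlled by a majorant `my` given in restart (Duhamel) form.

* `levelOneBond_exp_quarter_le`, `levelOneBond_exp_neg_two_ge` — `e^{1/4} ≤ 4/3`, `e^{-2} ≥ 1/8`.
* `levelOneBond_const_mul_le_integral` — `c (b - a) ≤ ∫_a^b g` if `g ≥ c` is continuous.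
* `levelOneBond_rate_bounds` — `−5/2 ≤ K ≤ q⁵|β|`.
* `levelOneBond_forcing_abs_le` — `|y(qβ − x₂/q) + ε̄q²β²| ≤ |y|(qB_β + 1) + ε̄q²B_β²`.
* `levelOneBond_duhamel` — variation of constants `y = e^{Γ}(y(0) + ∫₀ e^{-Γ} f)`, `Γ = ∫₀ K`,
  from both bounds of the landed comparison principle (`linearComparison_upper/lower`).
* `levelOneBond_exp_primitive_diff_le`, `levelOneBond_primitive_le` — `e^{Γ(s) − Γ(u)} ≤ 4/3`
  for `s ≤ u` (as `K ≥ −5/2`, `T ≤ 1/10`) and `Γ ≤ q⁵ ∫₀|β|`.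
* `levelOneBond_memory_le`, `levelOneBond_majorant_le` — the memory integral and the bond
  majorant under a pointwise bound `|y| ≤ Y`: `my ≤ 4ε̄ + q⁴ (Y (qB_β+1) + ε̄q²B_β²) σ`.
* `levelOneBond_arith` — the smallness bookkeeping: with `η (qB_β+1)³ ≤ 10⁻⁶` the memory
  feedback is `≤ ε̄/10⁶` and the forcing rate of the Duhamel bracket is `≤ 2 ε̄q²B_β²`.

## References

Folklore (variation of constants / Grönwall bookkeeping), used as in T. Tao, *Finite time blowup
for an averaged three-dimensional Navier–Stokes equation*, J. Amer. Math. Soc. 29 (2016), §5–6.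
-/

noncomputable section

-- the summit namespace `…NavierStokesRegularity.NavierStokesRegularity…` is the tree convention
set_option linter.dupNamespace false

open MeasureTheory Set Filter Topology

namespace Summit.NavierStokesRegularity.NavierStokesRegularity.Theorems.PerpetualPumpAveragedTypeIBlowup

/-- `e^{1/4} ≤ 4/3` (from `1 + x ≤ eˣ` at `x = -1/4`). [folklore] -/
theorem levelOneBond_exp_quarter_le : Real.exp (1 / 4) ≤ 4 / 3 := by
  have h1 : (3 : ℝ) / 4 ≤ Real.exp (-(1 / 4)) := by
    have := Real.add_one_le_exp (-(1 / 4 : ℝ))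
    linarith
  calc Real.exp (1 / 4) = (Real.exp (-(1 / 4)))⁻¹ := by rw [Real.exp_neg, inv_inv]
    _ ≤ (3 / 4)⁻¹ := inv_anti₀ (by norm_num) h1
    _ = 4 / 3 := by norm_num

/-- `e^{-2} ≥ 1/8` (from `e < 2.7182818286`). [folklore] -/
theorem levelOneBond_exp_neg_two_ge : (1 : ℝ) / 8 ≤ Real.exp (-2) := by
  have h := Real.exp_one_lt_d9
  have h2 : Real.exp 2 = Real.exp 1 * Real.exp 1 := by
    rw [← Real.exp_add]
    norm_num
  have h3 : Real.exp 2 ≤ 8 := by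
    rw [h2]
    nlinarith [Real.exp_pos (1 : ℝ)]
  rw [Real.exp_neg, one_div]
  exact inv_anti₀ (Real.exp_pos 2) h3

/-- A function continuous on `[a, b]` and bounded below by `c` there has integral at least
`c (b - a)`. [folklore] -/
theorem levelOneBond_const_mul_le_integral {g : ℝ → ℝ} {a b c : ℝ} (hab : a ≤ b)
    (hg : ContinuousOn g (Icc a b)) (h : ∀ x ∈ Icc a b, c ≤ g x) :
    c * (b - a) ≤ ∫ x in a..b, g x := by
  have h1 := intervalIntegral.integral_mono_on hab (intervalIntegrable_const (μ := volume))
    (hg.intervalIntegrable_of_Icc hab) h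
  rwa [intervalIntegral.integral_const, smul_eq_mul, mul_comm] at h1

/-- **Bounds on the rate.** `K = q⁴(qβ − x₂/q − 1) ≤ q⁵|β|` (as `x₂/q ≥ −1/2`) and
`K ≥ −5/2` (as `β ≥ −1/50`, `x₂/q ≤ 1/2`, `q ≤ 21/20`). [folklore] -/
theorem levelOneBond_rate_bounds {q b x : ℝ} (hq1 : 1 ≤ q) (hq2 : q ≤ 21 / 20)
    (hb : -(1 / 50) ≤ b) (hx : |x| ≤ 1 / 2) :
    q ^ 4 * (q * b - x / q - 1) ≤ q ^ 5 * |b| ∧ -(5 / 2) ≤ q ^ 4 * (q * b - x / q - 1) := by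
  have hq0 : 0 < q := by linarith
  have hxq : |x / q| ≤ 1 / 2 := by
    rw [abs_div, abs_of_pos hq0, div_le_iff₀ hq0]
    nlinarith [abs_nonneg x]
  obtain ⟨hw1, hw2⟩ := abs_le.1 hxq
  have hq5 : q ^ 5 ≤ (21 / 20) ^ 5 := pow_le_pow_left₀ hq0.le hq2 5
  have hq45 : q ^ 4 ≤ q ^ 5 := pow_le_pow_right₀ hq1 (by norm_num)
  have hq40 : 0 < q ^ 4 := by positivity
  have e : q ^ 4 * (q * b - x / q - 1) = q ^ 5 * b - q ^ 4 * (x / q) - q ^ 4 := by ring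
  have h5b : q ^ 5 * (-(1 / 50)) ≤ q ^ 5 * b := mul_le_mul_of_nonneg_left hb (by positivity)
  have h5b' : q ^ 5 * b ≤ q ^ 5 * |b| := mul_le_mul_of_nonneg_left (le_abs_self b) (by positivity)
  have h4w : q ^ 4 * (x / q) ≤ q ^ 4 * (1 / 2) := mul_le_mul_of_nonneg_left hw2 hq40.le
  have h4w' : q ^ 4 * (-(1 / 2)) ≤ q ^ 4 * (x / q) := mul_le_mul_of_nonneg_left hw1 hq40.le
  rw [e]
  constructor
  · nlinarith
  · nlinarith

/-- **Pointwise bound on the forcing of the bond majorant.**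
`|y(qβ − x₂/q) + ε̄q²β²| ≤ |y|(qB_β + 1) + ε̄q²B_β²`. [folklore] -/
theorem levelOneBond_forcing_abs_le {q εb Bβ yv b x : ℝ} (hq1 : 1 ≤ q) (hεb : 0 < εb)
    (hb1 : -(1 / 50) ≤ b) (hb2 : b ≤ Bβ) (hB : 10 ^ 4 ≤ Bβ) (hx : |x| ≤ 1 / 2) :
    |yv * (q * b - x / q) + εb * q ^ 2 * b ^ 2| ≤
      |yv| * (q * Bβ + 1) + εb * q ^ 2 * Bβ ^ 2 := by
  have hq0 : 0 < q := by linarith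
  have hbabs : |b| ≤ Bβ := abs_le.2 ⟨by linarith, hb2⟩
  have hxq : |x / q| ≤ 1 / 2 := by
    rw [abs_div, abs_of_pos hq0, div_le_iff₀ hq0]
    nlinarith [abs_nonneg x]
  have h1 : |q * b - x / q| ≤ q * Bβ + 1 := by
    calc |q * b - x / q| ≤ |q * b| + |x / q| := abs_sub _ _
      _ ≤ q * Bβ + 1 := by
          rw [abs_mul, abs_of_pos hq0]
          nlinarith [mul_le_mul_of_nonneg_left hbabs hq0.le]
  have h2 : b ^ 2 ≤ Bβ ^ 2 := sq_le_sq' (by linarith) hb2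
  calc |yv * (q * b - x / q) + εb * q ^ 2 * b ^ 2|
      ≤ |yv * (q * b - x / q)| + |εb * q ^ 2 * b ^ 2| := abs_add_le _ _
    _ = |yv| * |q * b - x / q| + εb * q ^ 2 * b ^ 2 := by
        rw [abs_mul, abs_of_nonneg (by positivity : (0 : ℝ) ≤ εb * q ^ 2 * b ^ 2)]
    _ ≤ |yv| * (q * Bβ + 1) + εb * q ^ 2 * Bβ ^ 2 :=
        add_le_add (mul_le_mul_of_nonneg_left h1 (abs_nonneg _))
          (mul_le_mul_of_nonneg_left h2 (by positivity))

/-- **Variation of constants.** If `y' = K y + f` inside `[0, T]` with `y, K, f` continuous on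
`[0, T]`, then `y(σ) = e^{Γ(σ)} (y(0) + ∫₀^σ e^{-Γ} f)` with `Γ = ∫₀ K` (both bounds of the
landed comparison principle). [folklore] -/
theorem levelOneBond_duhamel :
    ∀ {y K f : ℝ → ℝ} {T : ℝ}, 0 ≤ T → ContinuousOn K (Icc 0 T) → ContinuousOn f (Icc 0 T) →
      ContinuousOn y (Icc 0 T) → (∀ t ∈ Ioo 0 T, HasDerivAt y (K t * y t + f t) t) →
      ∀ {σ : ℝ}, σ ∈ Icc 0 T → y σ = Real.exp (∫ s in (0 : ℝ)..σ, K s) *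
        (y 0 + ∫ s in (0 : ℝ)..σ, Real.exp (-(∫ u in (0 : ℝ)..s, K u)) * f s) :=
  fun hT hK hf hy hd _ hσ =>
    le_antisymm (linearComparison_upper hT hK hf hy (fun t ht => ⟨_, hd t ht, le_rfl⟩) hσ)
      (linearComparison_lower hT hK hf hy (fun t ht => ⟨_, hd t ht, le_rfl⟩) hσ)

/-- **Bounded back-amplification.** If `K ≥ -5/2` on `[0, T]` with `T ≤ 1/10`, then
`e^{Γ(s) − Γ(u)} ≤ 4/3` for `0 ≤ s ≤ u ≤ T`, `Γ = ∫₀ K`. [folklore] -/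
theorem levelOneBond_exp_primitive_diff_le {K : ℝ → ℝ} {T s u : ℝ} (hT : T ≤ 1 / 10)
    (hK : ContinuousOn K (Icc 0 T)) (hKge : ∀ t ∈ Icc 0 T, -(5 / 2) ≤ K t)
    (hs : 0 ≤ s) (hsu : s ≤ u) (hu : u ≤ T) :
    Real.exp ((∫ t in (0 : ℝ)..s, K t) - ∫ t in (0 : ℝ)..u, K t) ≤ 4 / 3 := by
  have hi : ∀ a b, 0 ≤ a → a ≤ b → b ≤ T → IntervalIntegrable K volume a b :=
    fun a b ha hab hb => (hK.mono (Icc_subset_Icc ha hb)).intervalIntegrable_of_Icc hab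
  have h1 : (∫ t in (0 : ℝ)..u, K t) - ∫ t in (0 : ℝ)..s, K t = ∫ t in s..u, K t :=
    intervalIntegral.integral_interval_sub_left (hi 0 u le_rfl (hs.trans hsu) hu)
      (hi 0 s le_rfl hs (hsu.trans hu))
  have h2 : -(5 / 2) * (u - s) ≤ ∫ t in s..u, K t :=
    levelOneBond_const_mul_le_integral hsu (hK.mono (Icc_subset_Icc hs hu))
      (fun t ht => hKge t ⟨hs.trans ht.1, ht.2.trans hu⟩)
  calc Real.exp ((∫ t in (0 : ℝ)..s, K t) - ∫ t in (0 : ℝ)..u, K t)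
      ≤ Real.exp (1 / 4) := Real.exp_le_exp.2 (by linarith)
    _ ≤ 4 / 3 := levelOneBond_exp_quarter_le

/-- **Growth of the integrating factor.** If `K ≤ c |β|` on `[0, T]` then
`∫₀^u K ≤ c ∫₀^u |β|` for `u ∈ [0, T]`. [folklore] -/
theorem levelOneBond_primitive_le {K β : ℝ → ℝ} {T c u : ℝ}
    (hK : ContinuousOn K (Icc 0 T)) (hβ : ContinuousOn β (Icc 0 T))
    (hle : ∀ t ∈ Icc 0 T, K t ≤ c * |β t|) (hu0 : 0 ≤ u) (huT : u ≤ T) :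
    ∫ t in (0 : ℝ)..u, K t ≤ c * ∫ t in (0 : ℝ)..u, |β t| := by
  rw [← intervalIntegral.integral_const_mul]
  exact intervalIntegral.integral_mono_on hu0
    ((hK.mono (Icc_subset_Icc_right huT)).intervalIntegrable_of_Icc hu0)
    ((continuousOn_const.mul (hβ.mono (Icc_subset_Icc_right huT)).abs).intervalIntegrable_of_Icc
      hu0)
    fun t ht => hle t ⟨ht.1, ht.2.trans huT⟩

/-- **The memory integral under a pointwise bound on `y`.** If `|y| ≤ Y` on `[0, u]`
(`u ∈ [0, T]`), `β ∈ [-1/50, B_β]` and `|x₂| ≤ 1/2` on `[0, T]`, and `θ ≥ 0`, then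
`∫₀^u e^{-θq⁴(u-s)} |y(qβ − x₂/q) + ε̄q²β²| ds ≤ (Y (qB_β + 1) + ε̄q²B_β²) u`. [folklore] -/
theorem levelOneBond_memory_le {y β x2 : ℝ → ℝ} {q θ εb Bβ T u Y : ℝ} (hq1 : 1 ≤ q)
    (hθ : 0 ≤ θ) (hεb : 0 < εb) (hB : 10 ^ 4 ≤ Bβ)
    (hβb : ∀ σ ∈ Icc 0 T, -(1 / 50) ≤ β σ ∧ β σ ≤ Bβ) (hx2b : ∀ σ ∈ Icc 0 T, |x2 σ| ≤ 1 / 2)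
    (hu : u ∈ Icc 0 T) (hY : ∀ s ∈ Icc 0 u, |y s| ≤ Y) :
    (∫ s in (0 : ℝ)..u, Real.exp (-(θ * q ^ 4 * (u - s))) *
        |y s * (q * β s - x2 s / q) + εb * q ^ 2 * (β s) ^ 2|) ≤
      (Y * (q * Bβ + 1) + εb * q ^ 2 * Bβ ^ 2) * u := by
  have hq0 : 0 < q := by linarith
  have hB0 : 0 < Bβ := by linarith
  have hP0 : 0 ≤ q * Bβ + 1 := by positivity
  have h := intervalIntegral.norm_integral_le_of_norm_le_const (a := (0 : ℝ)) (b := u)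
    (C := Y * (q * Bβ + 1) + εb * q ^ 2 * Bβ ^ 2)
    (f := fun s => Real.exp (-(θ * q ^ 4 * (u - s))) *
      |y s * (q * β s - x2 s / q) + εb * q ^ 2 * (β s) ^ 2|) ?_
  · rw [Real.norm_eq_abs, sub_zero, abs_of_nonneg hu.1] at h
    exact (le_abs_self _).trans h
  · intro s hs
    rw [uIoc_of_le hu.1] at hs
    have hsT : s ∈ Icc 0 T := ⟨hs.1.le, hs.2.trans hu.2⟩
    rw [Real.norm_eq_abs, abs_mul, Real.abs_exp, abs_abs]
    have he1 : Real.exp (-(θ * q ^ 4 * (u - s))) ≤ 1 := by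
      rw [Real.exp_le_one_iff, neg_nonpos]
      exact mul_nonneg (by positivity) (by linarith [hs.2])
    have hF := levelOneBond_forcing_abs_le (yv := y s) hq1 hεb (hβb s hsT).1 (hβb s hsT).2
      hB (hx2b s hsT)
    calc Real.exp (-(θ * q ^ 4 * (u - s))) *
          |y s * (q * β s - x2 s / q) + εb * q ^ 2 * (β s) ^ 2|
        ≤ 1 * (|y s| * (q * Bβ + 1) + εb * q ^ 2 * Bβ ^ 2) :=
          mul_le_mul he1 hF (abs_nonneg _) zero_le_one
      _ ≤ Y * (q * Bβ + 1) + εb * q ^ 2 * Bβ ^ 2 := by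
          rw [one_mul]
          exact add_le_add_left (mul_le_mul_of_nonneg_right (hY s ⟨hs.1.le, hs.2⟩) hP0) _

/-- **The bond majorant under a pointwise bound on `y`.** In the situation of
`levelOneBond_memory_le`, a quantity bounded in restart form,
`mσ ≤ m e^{-θq⁴σ} + q⁴ ∫₀^σ e^{-θq⁴(σ-s)} |y(qβ − x₂/q) + ε̄q²β²| ds` with `0 ≤ m ≤ m₀`, obeys
`mσ ≤ m₀ + q⁴ (Y (qB_β + 1) + ε̄q²B_β²) σ`. [folklore] -/
theorem levelOneBond_majorant_le {y β x2 : ℝ → ℝ} {q θ εb Bβ T σ Y m m0 mσ : ℝ} (hq1 : 1 ≤ q)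
    (hθ : 0 ≤ θ) (hεb : 0 < εb) (hB : 10 ^ 4 ≤ Bβ)
    (hβb : ∀ σ ∈ Icc 0 T, -(1 / 50) ≤ β σ ∧ β σ ≤ Bβ) (hx2b : ∀ σ ∈ Icc 0 T, |x2 σ| ≤ 1 / 2)
    (hσ : σ ∈ Icc 0 T) (hY : ∀ s ∈ Icc 0 σ, |y s| ≤ Y) (hm0 : 0 ≤ m) (hm : m ≤ m0)
    (hmσ : mσ ≤ m * Real.exp (-(θ * q ^ 4 * σ)) +
      q ^ 4 * ∫ s in (0 : ℝ)..σ, Real.exp (-(θ * q ^ 4 * (σ - s))) *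
        |y s * (q * β s - x2 s / q) + εb * q ^ 2 * (β s) ^ 2|) :
    mσ ≤ m0 + q ^ 4 * ((Y * (q * Bβ + 1) + εb * q ^ 2 * Bβ ^ 2) * σ) := by
  have hq0 : 0 < q := by linarith
  have hI := levelOneBond_memory_le hq1 hθ hεb hB hβb hx2b hσ hY
  have hex1 : Real.exp (-(θ * q ^ 4 * σ)) ≤ 1 := by
    rw [Real.exp_le_one_iff, neg_nonpos]
    exact mul_nonneg (by positivity) hσ.1
  have h1 : m * Real.exp (-(θ * q ^ 4 * σ)) ≤ m0 * 1 :=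
    mul_le_mul hm hex1 (Real.exp_pos _).le (hm0.trans hm)
  have h2 := mul_le_mul_of_nonneg_left hI (by positivity : (0 : ℝ) ≤ q ^ 4)
  linarith

/-- **The smallness bookkeeping.** With `P = qB_β + 1 ≥ 10⁴`, `E = ε̄q²B_β² ≤ 1` and
`η P³ ≤ 10⁻⁶`, the self-consistent bound on the supremum `M` of the Duhamel bracket forces the
memory feedback to be at most `ε̄/10⁶` and the total forcing rate to be at most `2E`. [folklore] -/
theorem levelOneBond_arith {q η εb Bβ y0 M : ℝ} (hq1 : 1 ≤ q) (hq2 : q ≤ 21 / 20) (hη : 0 ≤ η)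
    (hεb : 0 < εb) (hB : 10 ^ 4 ≤ Bβ)
    (hηP : η * (q * Bβ + 1) ^ 3 ≤ 1 / 10 ^ 6) (hy0 : 0 ≤ y0) (hy0ε : y0 ≤ 2 * εb)
    (hM0 : 0 ≤ M)
    (hM : M ≤ y0 + (4 / 3 * (q ^ 4 * (εb * q ^ 2 * Bβ ^ 2)) +
      η * q ^ 4 * (4 / 3 * (4 * εb) + q ^ 4 * ((4 / 3 * M * (q * Bβ + 1) +
        4 / 3 * (εb * q ^ 2 * Bβ ^ 2)) * (1 / 10)))) * (1 / 10)) :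
    η * q ^ 4 * (4 / 3 * (4 * εb) + q ^ 4 * ((4 / 3 * M * (q * Bβ + 1) +
        4 / 3 * (εb * q ^ 2 * Bβ ^ 2)) * (1 / 10))) ≤ εb / 10 ^ 6 ∧
    4 / 3 * (q ^ 4 * (εb * q ^ 2 * Bβ ^ 2)) +
      η * q ^ 4 * (4 / 3 * (4 * εb) + q ^ 4 * ((4 / 3 * M * (q * Bβ + 1) +
        4 / 3 * (εb * q ^ 2 * Bβ ^ 2)) * (1 / 10))) ≤ 2 * (εb * q ^ 2 * Bβ ^ 2) := by
  have hq0 : 0 < q := by linarith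
  have hB0 : 0 < Bβ := by linarith
  have hq4 : q ^ 4 ≤ (21 / 20) ^ 4 := pow_le_pow_left₀ hq0.le hq2 4
  have hq8 : q ^ 8 ≤ (21 / 20) ^ 8 := pow_le_pow_left₀ hq0.le hq2 8
  have hq40 : 0 < q ^ 4 := by positivity
  -- facts linking `E = ε̄q²B_β²`, `P = qB_β + 1` to the raw parameters; then generalize them
  have hEP : εb * q ^ 2 * Bβ ^ 2 ≤ εb * (q * Bβ + 1) ^ 2 := by nlinarith [mul_pos hq0 hB0]
  have hEε : 10 ^ 8 * εb ≤ εb * q ^ 2 * Bβ ^ 2 := by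
    have h1 : (10 : ℝ) ^ 8 ≤ Bβ ^ 2 := by nlinarith
    have h2 : (1 : ℝ) ≤ q ^ 2 := one_le_pow₀ hq1
    have h3 : (1 : ℝ) * 10 ^ 8 ≤ q ^ 2 * Bβ ^ 2 := mul_le_mul h2 h1 (by norm_num) (by positivity)
    nlinarith
  have hP : (10 : ℝ) ^ 4 ≤ q * Bβ + 1 := by nlinarith
  obtain ⟨P, hPd⟩ : ∃ P : ℝ, P = q * Bβ + 1 := ⟨_, rfl⟩
  obtain ⟨E, hEd⟩ : ∃ E : ℝ, E = εb * q ^ 2 * Bβ ^ 2 := ⟨_, rfl⟩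
  rw [← hPd] at hηP hM hEP hP ⊢
  rw [← hEd] at hM hEP hEε ⊢
  have hP0 : 0 < P := by linarith
  have hE0 : 0 < E := by linarith
  -- `η` against powers of `P`
  have hP2 : (10 : ℝ) ^ 8 ≤ P ^ 2 := by nlinarith
  have hP3 : (10 : ℝ) ^ 12 ≤ P ^ 3 := by nlinarith
  have hη0 : η ≤ 1 / 10 ^ 18 := by
    have h := mul_le_mul_of_nonneg_left hP3 hη
    linarith
  have hη1 : η * P ≤ 1 / 10 ^ 14 := by
    have h : η * P * 10 ^ 8 ≤ η * P * P ^ 2 := mul_le_mul_of_nonneg_left hP2 (by positivity)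
    have h2 : η * P * P ^ 2 = η * P ^ 3 := by ring
    linarith
  have hη2 : η * P ^ 2 ≤ 1 / 10 ^ 10 := by
    have h : η * P ^ 2 * 10 ^ 4 ≤ η * P ^ 2 * P := mul_le_mul_of_nonneg_left hP (by positivity)
    have h2 : η * P ^ 2 * P = η * P ^ 3 := by ring
    linarith
  -- basic products
  have p1 : η * εb ≤ 1 / 10 ^ 18 * εb := mul_le_mul_of_nonneg_right hη0 hεb.le
  have p2 : η * E ≤ 1 / 10 ^ 10 * εb := by
    calc η * E ≤ η * (εb * P ^ 2) := mul_le_mul_of_nonneg_left hEP hη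
      _ = η * P ^ 2 * εb := by ring
      _ ≤ 1 / 10 ^ 10 * εb := mul_le_mul_of_nonneg_right hη2 hεb.le
  have p3 : η * P * E ≤ 1 / 10 ^ 6 * εb := by
    calc η * P * E ≤ η * P * (εb * P ^ 2) := mul_le_mul_of_nonneg_left hEP (by positivity)
      _ = η * P ^ 3 * εb := by ring
      _ ≤ 1 / 10 ^ 6 * εb := mul_le_mul_of_nonneg_right hηP hεb.le
  -- the self-consistent bound on `m = η P M`
  have hm0 : 0 ≤ η * P * M := by positivity
  have hMt : η * P * M ≤ η * P * (y0 + (4 / 3 * (q ^ 4 * E) +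
      η * q ^ 4 * (4 / 3 * (4 * εb) + q ^ 4 * ((4 / 3 * M * P + 4 / 3 * E) * (1 / 10)))) *
        (1 / 10)) := mul_le_mul_of_nonneg_left hM (by positivity)
  have f1 : η * P * y0 ≤ 1 / 10 ^ 14 * y0 := mul_le_mul_of_nonneg_right hη1 hy0
  have f2 : q ^ 4 * (η * P * E) ≤ (21 / 20) ^ 4 * (1 / 10 ^ 6 * εb) :=
    mul_le_mul hq4 p3 (by positivity) (by positivity)
  have f3 : q ^ 4 * (η * P) * (η * εb) ≤ (21 / 20) ^ 4 * (1 / 10 ^ 14) * (1 / 10 ^ 18 * εb) :=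
    mul_le_mul (mul_le_mul hq4 hη1 (by positivity) (by positivity)) p1 (by positivity)
      (by positivity)
  have f4 : q ^ 8 * (η * P) * (η * P * M) ≤ (21 / 20) ^ 8 * (1 / 10 ^ 14) * (η * P * M) :=
    mul_le_mul_of_nonneg_right (mul_le_mul hq8 hη1 (by positivity) (by positivity)) hm0
  have f5 : q ^ 8 * (η * P) * (η * E) ≤ (21 / 20) ^ 8 * (1 / 10 ^ 14) * (1 / 10 ^ 10 * εb) :=
    mul_le_mul (mul_le_mul hq8 hη1 (by positivity) (by positivity)) p2 (by positivity)
      (by positivity)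
  have hm : η * P * M ≤ 2 / 10 ^ 7 * εb := by linarith
  -- the memory feedback and the total forcing rate
  have g1 : q ^ 4 * (η * εb) ≤ (21 / 20) ^ 4 * (1 / 10 ^ 18 * εb) :=
    mul_le_mul hq4 p1 (by positivity) (by positivity)
  have g2 : q ^ 8 * (η * P * M) ≤ (21 / 20) ^ 8 * (2 / 10 ^ 7 * εb) :=
    mul_le_mul hq8 hm hm0 (by positivity)
  have g3 : q ^ 8 * (η * E) ≤ (21 / 20) ^ 8 * (1 / 10 ^ 10 * εb) :=
    mul_le_mul hq8 p2 (by positivity) (by positivity)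
  have herr : η * q ^ 4 * (4 / 3 * (4 * εb) + q ^ 4 * ((4 / 3 * M * P + 4 / 3 * E) * (1 / 10))) ≤
      εb / 10 ^ 6 := by linarith
  refine ⟨herr, ?_⟩
  have g4 : q ^ 4 * E ≤ (21 / 20) ^ 4 * E := mul_le_mul_of_nonneg_right hq4 hE0.le
  linarith

end Summit.NavierStokesRegularity.NavierStokesRegularity.Theorems.PerpetualPumpAveragedTypeIBlowup

end
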